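import Summits.BirchSwinnertonDyer.BirchSwinnertonDyer.Theorems.EisensteinPrimesB11SplitRoutePDoor
import Summits.BirchSwinnertonDyer.BirchSwinnertonDyer.Theorems.EisensteinPrimesB11L3MainConjecture
import Summits.BirchSwinnertonDyer.BirchSwinnertonDyer.Theorems.EisensteinPrimesB11L3Cert1210g1
import Summits.BirchSwinnertonDyer.Rank1Residual.X11b.ChaPairsMinimality
import Summits.BirchSwinnertonDyer.Rank1Residual.Supersingular.IntModelMinimalityKrausTwoMore
import Summits.BirchSwinnertonDyer.BirchSwinnertonDyer.Theorems.Rank1ResidualX11RankOneReduction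
import Summits.BirchSwinnertonDyer.Rank1Residual.Partition.EisensteinKernelCertificate
import HarnessLib

/-!
# Row B11 = cell X2c (rank 1, Eisenstein, `5 ‖ N`), sub-cell `X2.CellCSplitGV`, SPLIT, `λ_an = 4`: Mazur's cyclotomic
# main conjecture at `(1210g1, 5)` on TWO Keller–Yin-free roads — route P at a split prime (door
# `B11SplitRouteP.mazurMC_of_cellC_of_split_of_routeP`, p545576) and the L3 certificate (door
# `B11L3.cellC_mazurMainConjectureAt_of_split_of_thm16_of_l3Certificate`, p547040) — plus `BSD(1210g1, 5)` from the
# same L3 certificate (k5-p3's door), modulo PUBLISHED facts + the pair's instrument readings (cell `bsd-eis`,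
# seat `bsd-eis-k5-c4` gen 10; route `EisensteinPrimes`, crux 4 `BSDpOnCellC` = `X2.TargetC` =
# stmt-BirchSwinnertonDyer-19034; THEOREMS ONLY; generated by `work/disp/gen_rpsplit.py`; membership template =
# k5-p3 `gen_l3.py` / k5-c4 g8 `gen_display.py` / p427884)

HONEST FRAMING (FULL-BSD rank-≤1 programme D-0033, cell `bsd-eis`, home `run/shared/lean/pub/bsd-eis/`;
row B11 = X2c: 12 665 census cells `(E, p)` with `r_an = 1`, `p` odd, `p ‖ N`, `E[p]` reducible; O9 atlas
`class-closure/O9/E2-hypotheses.tsv`). Nothing is booked here and no label or count moves: X2c stays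
CONSTRUCTION-SHAPED as a class; BSD is proved for no curve by this file unconditionally. Per-pair CONDITIONAL
theorems: the class-level inputs are the tree's registered PUBLISHED facts BY NAME, the per-pair inputs are
instrument READINGS (two engines each, named below).

TARGET `W = 1210g1 = [1, 1, 0, 1208, 65696]` (Cremona `allcurves`, reduced minimal model): `N = 1210 = 2·5·11²`,
`Δ = -1948717100000` (`|Δ| = 2⁵·5⁵·11⁷`), `c₄ = -57959`, `c₆ = -56326589`; Cremona `allcurves`/`allbsd`/`allgens`: `r = 1`,
`#E(ℚ)_tors = 1`, `∏ c_v = 20`, `Ω = 0.610387396618395`, `L'(E,1) = 1.68595019888913`, `Reg = 0.138104932066869`, `Ш_an = 1.00000000000000`, generator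
`P = [127:1449:1]`; isogeny class `1210g` (Cremona `allisog`: curves [1,1,0,1208,65696], degree matrix [[1,1,0,1208,65696],[1,1,0,-718742,234235786]]).
O9 atlas row `1210g1@5`: sub-cell `split-GV = Summit.BirchSwinnertonDyer.Rank1Residual.X2.CellCSplitGV`; `ord_5 #Ш_an = 0`; booking of record `B11 row of record (planner b11status, R796)` (referee B R796).

KERNEL MEMBERSHIP (ellipticity, global minimality, SPLIT multiplicative at `5`, `W[5]` reducible, `ClassX2 W 5`) is IMPORTED from the landed display `Theorems/EisensteinPrimesB11L3Cert1210g1.lean` (`B11L3Cert1210g1.classX2_1210g1`, `B11L3Cert1210g1.split_1210g1`), not restated.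
PER-PAIR INSTRUMENT READINGS (hypotheses, not mathematics of this file; keys `HOME/k5-c4-g10/B11S-RP-keys.tsv` +
`B11-L3W1b-vb2-keys.tsv` row `1210g1@5`): `hr : r_an = 1` [Cremona `allbsd` ‖ PARI]; `hμ0 : AnalyticMuLE W 5 0`,
`hlam4 : AnalyticLambdaEq W 5 4` [(μ, λ) = (0, 4): A PARI `ellpadiclambdamu` ‖ B msengine (`O9/LAMMIN-CLASS-typer6.tsv`
(0,4) A=B) ‖ C this seat's engine v5 exact Mazur–Tate element (kit j283329, two levels)]; `hk : k = 1 ≤ ord_5 𝓛_5` for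
every Tate parameter datum [`R4`: PARI Tate `q` ‖ own `q` by j-inversion, k5-p3 JD #39]; `hv : v = 1 ≤ ord_5 Reg_5` for THE
split §4.2 height whenever `Reg_5 ≠ 0` [`R3`: PARI `ellpadicregulator` ‖ census REG-MULT σ-height, e1 = e2 = 1];
`ord_5 #E(ℚ)_tors = 0`, `ord_5 ∏c_v = 1` [Cremona `allbsd`] — so the route-P inequality reads
`2 + 2·0 < 1 + 1 + 1` ✓; `hcert` (L3, the binder of record R788): `ord_{T=0} L = 2` and
`v_5(ϖ·[T²]L·log_5(γ_cyc)²·#tors²) = v_5(𝓛_5·∏c_v·Reg_5)` [engine C v5: `v_5(b₂) = 1` exact, conclusive at level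
`K` (`< K − 1`), trivial-zero check `b₁ ≡ 0 (mod 5^(K−1))` ✓; identity `1 + 2 + 2·0 = 1 + 1 + 1` ✓ ‖ E1 = PARI
`ellpadicbsd` (k5-p3 LEG W-E1)]; `hsha : 5 ∤ #Ш_an` [Cremona: `Ш_an = 1.00000000000000`].
CLASS-LEVEL INPUTS, all REGISTERED Literature facts [PUB] BY NAME: `hWu` Wuthrich 2014 Thm. 16, `hJs`/`hJn` Stein–Wuthrich
2013 Thm. 6.1, `h310` Greenberg LNM 1716 Prop. 3.10, `hGZ` Gross–Zagier I.7.3, `hGZK`, `hpar`. No Greenberg–Vatsal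
fact (the roads are parity-free), no partner / relative / twist, no anticyclotomic object, no Schneider hypothesis, no
`_OPEN` / preprint fact, no crux 3: KELLER–YIN-FREE.

* §3a `mazurMC_1210g1_at_five_routeP` — route P (split): `(μ,λ) = (0,4)` + `k` + `v` + inequality ⟹ `X2.MazurMainConjectureAt W 5`.
* §3b `mazurMC_1210g1_at_five_l3` — the L3 certificate (k5-p3 g2's door) ⟹ `X2.MazurMainConjectureAt W 5` (second road,
  disjoint readings on the L-side: no `(μ, λ)`, no inequality).
* §3c `targetC_1210g1_at_five_l3` (BSDp half = k5-p3's LANDED `B11L3Cert1210g1.bsdp_1210g1_at_five_l3`) — the SAME certificate + `hsha` ⟹ `BSDp W 5` (k5-p3's door;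
  crux 4's `X2.TargetC` shape).
What this is NOT: not a booking; not the crux (the CLASS); `BSD(E,p)` does NOT come from route P at a split prime
(exceptional-zero leading term for reducible `E[p]` = typed conjecture `O9.ExceptionalLeadingTermAt`) — it comes from §3c.
Refs: [GreenbergLNM1716] Prop. 3.10, §5 p. 183 (printed p. 142); [Wuthrich2014] Thm. 16 (p. 397); [SteinWuthrich2013]
Thm. 6.1 (p. 20), §4.2, §4.4, §11 remark (p. 29); [SilvermanAEC2009] VII.1 Rem. 1.1, VII.5 Prop. 5.1(b), Ex. 3.7;
[Kraus1989] Prop. 1–2; [Miller2011LMS] Def. 1.1, Prop. 7.6; Cremona `ecdata`.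
-/

set_option autoImplicit false
set_option linter.dupNamespace false

noncomputable section

open scoped Classical MatrixGroups ModularForm

open WeierstrassCurve NumberField IsDedekindDomain Polynomial CongruenceSubgroup
  Literature.NumberTheory.EllipticCurves
  Literature.NumberTheory.EllipticCurves.ModularForms
  Literature.NumberTheory.EllipticCurves.Rank1Residual
  Literature.NumberTheory.EllipticCurves.Rank1Residual.Typed
  Literature.NumberTheory.EllipticCurves.Greenberg1999
  Literature.NumberTheory.EllipticCurves.Wuthrich2014
  Literature.NumberTheory.EllipticCurves.SteinWuthrich2013
  Summit.BirchSwinnertonDyer.BirchSwinnertonDyer.Rank1Residual.IntModel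
  Summit.BirchSwinnertonDyer.BirchSwinnertonDyer.Rank1Residual.X11RankOne
  Summit.BirchSwinnertonDyer.Rank1Residual.X11b
  Summit.BirchSwinnertonDyer.Rank1Residual
  Summit.BirchSwinnertonDyer.Rank1Residual.X2
  Summit.BirchSwinnertonDyer.Rank1Residual.Additive
  Summit.BirchSwinnertonDyer.BirchSwinnertonDyer.Theorems

namespace Summit.BirchSwinnertonDyer.BirchSwinnertonDyer.Theorems.B11SplitRouteP1210g1

/-! ## §1–§2 Membership: IMPORTED, not restated — `B11L3Cert1210g1.isElliptic_1210g1`, `B11L3Cert1210g1.isGloballyMinimal_1210g1`,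
`B11L3Cert1210g1.split_1210g1`, `B11L3Cert1210g1.not_irreducible_1210g1`, `B11L3Cert1210g1.classX2_1210g1` (landed display `Theorems/EisensteinPrimesB11L3Cert1210g1.lean`). -/

/-! ## §3 The displays -/

/-- **X2c INSTANCE — Mazur's main conjecture at `(1210g1, 5)` by ROUTE P at a split prime** (row B11, sub-cell
`X2.CellCSplitGV`, `λ_an = 4`): door `B11SplitRouteP.mazurMC_of_cellC_of_split_of_routeP` (Kato–Wuthrich divisibility +
Greenberg's parity Prop. 3.10 + Stein–Wuthrich Thm. 6.1 with THE split §4.2 height); `CellC W 5` holds in the kernel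
given the rank (`B11L3Cert1210g1.classX2_1210g1`), `B11L3Cert1210g1.split_1210g1` is the sign. CONDITIONAL only on the readings `hr`, `hμ0`, `hlam4`,
`hk` (`k = 1`), `hv` (`v = 1`), `hvt : ord_5 #tors = 0`, `hvc : ord_5 ∏c_v = 1` (the inequality
`2 + 2·0 < 1 + 1 + 1` is then arithmetic). [cite: GreenbergLNM1716, Prop. 3.10 and §5 p. 183]
[cite: Wuthrich2014, Thm. 16 (p. 397)] [cite: SteinWuthrich2013, Thm. 6.1 (p. 20), §4.2, §4.4 (p. 18)] -/
theorem mazurMC_1210g1_at_five_routeP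
    (hWu : thm16_charIdeal_dvd_multiplicative_of_reducible)
    (hJs : thm61_splitMultiplicative) (hJn : thm61_nonsplitMultiplicative)
    (h310 : prop310_selmerCorank_mod_two_eq_lambdaInvariant)
    (hGZK : rank_eq_analyticRank_of_analyticRank_le_one)
    (W : WeierstrassCurve ℚ) [W.IsElliptic] [W.IsGloballyMinimal] (hW : W = ⟨1, 1, 0, 1208, 65696⟩)
    (hr : W.analyticRank = 1) (hμ0 : AnalyticMuLE W 5 0) (hlam4 : AnalyticLambdaEq W 5 4)
    (hk : ∀ Dq : TateParameterData W 5, (1 : ℤ) ≤ (LInvariant Dq).valuation)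
    (hv : ∀ (Dq : TateParameterData W 5) (Dh : PAdicHeightData W 5), IsSplitMultCanonical Dh Dq →
      padicRegulator Dh ≠ 0 → (1 : ℤ) ≤ (padicRegulator Dh).valuation)
    (hvt : padicValNat 5 W.torsionOrder = 0) (hvc : padicValNat 5 W.tamagawaProduct = 1) :
    MazurMainConjectureAt W 5 := by
  subst hW
  refine B11SplitRouteP.mazurMC_of_cellC_of_split_of_routeP _ 5 hWu hJs hJn h310 hGZK ⟨hr, B11L3Cert1210g1.classX2_1210g1⟩
    B11L3Cert1210g1.split_1210g1 hμ0 hlam4 hk hv ?_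
  rw [hvt, hvc]; norm_num

/-- **X2c INSTANCE — Mazur's main conjecture at `(1210g1, 5)` by the L3 CERTIFICATE** (second road; door
`B11L3.cellC_mazurMainConjectureAt_of_split_of_thm16_of_l3Certificate`: the certificate EQUALITY forces the Kato–Wuthrich
cofactor to be a unit of Λ — Stein–Wuthrich §11 remark). CONDITIONAL only on `hr` and `hcert` (`ord_{T=0} L = 2` — its `≥` half is theory, its content `[T²]L ≠ 0` is engine C v5's
`v_5(b₂) = 1` conclusive read — and the valuation identity, two engines). No `(μ, λ)`, no parity, no inequality, no `hsha`.
[cite: SteinWuthrich2013, Thm. 6.1 (p. 20), §4.2 and §11 remark (p. 29)] [cite: Wuthrich2014, Thm. 16 (p. 397)] -/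
theorem mazurMC_1210g1_at_five_l3
    (hWu : thm16_charIdeal_dvd_multiplicative_of_reducible) (hJs : thm61_splitMultiplicative)
    (hGZK : rank_eq_analyticRank_of_analyticRank_le_one)
    (W : WeierstrassCurve ℚ) [W.IsElliptic] [W.IsGloballyMinimal] (hW : W = ⟨1, 1, 0, 1208, 65696⟩)
    (hr : W.analyticRank = 1)
    (hcert : ∀ {N : ℕ} [NeZero N] (f : CuspForm (Gamma0 N) 2), IsNewformOf W f →
      ∀ (ϖ : ℚ), (ϖ : ℝ) * W.realPeriodRat = plusPeriod f →
      ∀ (L : PowerSeries ℚ_[5]), IsSplitMultPAdicLFunctionOf f 5 L →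
      ∀ (Dq : TateParameterData W 5) (Dh : PAdicHeightData W 5), IsSplitMultCanonical Dh Dq →
        L.order = ((2 : ℕ) : ℕ∞) ∧
        (((ϖ : ℚ) : ℚ_[5]) * PowerSeries.coeff 2 L *
            (padicLog 5 (cyclotomicGenerator 5) ^ 2 * (W.torsionOrder : ℚ_[5]) ^ 2)).valuation =
          (LInvariant Dq * (W.tamagawaProduct : ℚ_[5]) * padicRegulator Dh).valuation) :
    MazurMainConjectureAt W 5 := by
  subst hW
  exact B11L3.cellC_mazurMainConjectureAt_of_split_of_thm16_of_l3Certificate _ 5 hWu hJs hGZK ⟨hr, B11L3Cert1210g1.classX2_1210g1⟩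
    B11L3Cert1210g1.split_1210g1 hcert

/-- **The pair on the route's cell predicate, both conclusions**: `CellC 1210g1 5 →` Mazur's main conjecture at the pair
`∧ BSD(1210g1, 5)`, modulo the published facts and ONE L3 certificate (+ `hsha`) — crux 4's `X2.TargetC` shape with the
main-conjecture rider; the `BSDp` half is the LANDED `B11L3Cert1210g1.bsdp_1210g1_at_five_l3` (k5-p3), reused, not restated. [cite: SteinWuthrich2013, Thm. 6.1 (p. 20) and §11 remark (p. 29)] [cite: Wuthrich2014, Thm. 16 (p. 397)] -/
theorem targetC_1210g1_at_five_l3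
    (hWu : thm16_charIdeal_dvd_multiplicative_of_reducible) (hJs : thm61_splitMultiplicative)
    (hGZ : GrossZagier1986_thm_I_7_3) (hGZK : rank_eq_analyticRank_of_analyticRank_le_one)
    (hpar : nonempty_modularParametrizationData)
    (W : WeierstrassCurve ℚ) [W.IsElliptic] [W.IsGloballyMinimal] (hW : W = ⟨1, 1, 0, 1208, 65696⟩)
    (hcert : ∀ {N : ℕ} [NeZero N] (f : CuspForm (Gamma0 N) 2), IsNewformOf W f →
      ∀ (ϖ : ℚ), (ϖ : ℝ) * W.realPeriodRat = plusPeriod f →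
      ∀ (L : PowerSeries ℚ_[5]), IsSplitMultPAdicLFunctionOf f 5 L →
      ∀ (Dq : TateParameterData W 5) (Dh : PAdicHeightData W 5), IsSplitMultCanonical Dh Dq →
        L.order = ((2 : ℕ) : ℕ∞) ∧
        (((ϖ : ℚ) : ℚ_[5]) * PowerSeries.coeff 2 L *
            (padicLog 5 (cyclotomicGenerator 5) ^ 2 * (W.torsionOrder : ℚ_[5]) ^ 2)).valuation =
          (LInvariant Dq * (W.tamagawaProduct : ℚ_[5]) * padicRegulator Dh).valuation)
    (hsha : ∀ s : ℚ, shaAn W = (s : ℂ) → padicValRat 5 s = 0) :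
    CellC W 5 → MazurMainConjectureAt W 5 ∧ BSDp W 5 :=
  fun hc ↦ ⟨mazurMC_1210g1_at_five_l3 hWu hJs hGZK W hW hc.1 hcert,
    B11L3Cert1210g1.bsdp_1210g1_at_five_l3 hWu hJs hGZ hGZK hpar W hW hc.1 hcert hsha⟩

end Summit.BirchSwinnertonDyer.BirchSwinnertonDyer.Theorems.B11SplitRouteP1210g1

end
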